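import Literature.NumberTheory.EllipticCurves.ZpExtensionEisensteinH3UnramifiedProofs
import Literature.NumberTheory.GaloisRepresentations.StrictSubgroupFunctorialityProofs
import Literature.NumberTheory.EllipticCurves.ZpExtensionEisensteinDVRSettingH3ReductionProofs
import Literature.NumberTheory.EllipticCurves.HeegnerPointsImaginaryQuadraticProofs
import HarnessLib

/-!
# Howard's H.3 for `F_𝔮` on the curve's Eisenstein tower at the places `v ∣ p` (saturated ORDINARY cores), over the
# level ring `A_{m,k+1}` (one definition with body — the plus part of the `π`-adic levels — and theorems; no named fact,
# no instance, no `sorry`)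

Topic `NumberTheory/EllipticCurves` (D1 road of cell `pub/bsd-print-x9`, `DVRSetting.SatisfiesH.h3` for
`WeierstrassCurve.eisensteinDVRSetting`; sequel to `ZpExtensionEisensteinH3UnramifiedProofs` (places `v ∤ p`, `∞`)).

B. Howard, Compositio Math. 140 (2004), H.3 (arXiv:1202.6340 p. 7 L65–67) for `F_𝔮` at `v ∣ p` (Def. 3.1.2, §3.1: `H¹_ord =
im H¹(K_v, Fil_v ·)`, propagated from `V_𝔮`; p. 16 L1–3).  In the tree `F_𝔮 (k+1) (Sum.inr v)` at `v ∣ p` is the level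
condition of the local `p`-adic tower with the strict ORDINARY cores `OrdinaryFiltration.ordinaryCore`
(`eisensteinSelmerStructure_inr_of_mem`).  With the plus parts of the `π`-adic levels
`FilG a = image of Fil_v T^{(host a)} in T/π^a` and the cores `H¹_str(K_v, T/π^a, FilG a)`, the generic assembly
`PiRefinementDatum.isCartesianOnQuotAt_levelCondition_of_finite` applies verbatim: core compatibilities from
`DiscreteGaloisModule.map_mem_strictSubgroup / map_strictSubgroup_eq_of_bijective` (`StrictSubgroupFunctorialityProofs`)
and `scalarMapH1_mem_strictSubgroup`, the two-index transitions `P ↦ p^{k'-k}P` preserving `Fil_v`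
(`OrdinaryFiltration.map_mem` iterated).

Main result **`WeierstrassCurve.isCartesianOnQuotAt_eisensteinSelmerStructure_of_mem`**: for `v ∣ p`,
`IsCartesianOnQuotAt ((W.eisensteinTower κ hm).ρ k) (EisensteinCoeff p m (k+1)) (Sum.inr v) (F_𝔮 (k+1) (Sum.inr v))`.
Together with `…_of_not_mem` (`v ∤ p`) and `eisensteinDVRSetting_h3_of` (complex places) this covers every
`v ∈ Σ(F) = ∞ ∪ S`:
**`WeierstrassCurve.eisensteinDVRSetting_h3`** — the hypothesis `h3` of
`eisensteinDVRSettingTame_satisfiesH_of` (`ZpExtensionEisensteinDVRSettingSatisfiesH`), discharged.  Nothing about Selmer groups of `E` is asserted; BSD is not proved by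
any of this.

References: [Howard2004HeegnerKolyvagin] H.3, Def. 1.1.2–1.1.3, §3.1, Def. 3.1.2 (arXiv p. 5, p. 7 L65–67, p. 15–16);
[MazurRubinMemoirs2004] Lemma 3.7.1; [GreenbergLNM1716] §2.
-/

set_option autoImplicit false

noncomputable section

open Function NumberField IsDedekindDomain Field
open scoped NumberField ContRepresentation Classical Pointwise TensorProduct

namespace WeierstrassCurve

open Literature.NumberTheory.EllipticCurves Literature.NumberTheory.GaloisRepresentations
open Literature.NumberTheory.GaloisRepresentations.DiscreteGaloisModule
open Literature.NumberTheory.EllipticCurves.ZpExtension (EisensteinLevel OrdinaryFiltration)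
open Literature.NumberTheory.GaloisCohomology.Howard2004

variable {K : Type} [Field K] [NumberField K] (E : WeierstrassCurve K) [E.IsElliptic] {p : ℕ} [hp : Fact p.Prime]
  (κ : Literature.NumberTheory.EllipticCurves.ZpExtension K p) {m : ℕ} (hm : 1 ≤ m) {v : HeightOneSpectrum (𝓞 K)}
  (Φ : OrdinaryFiltration (fun j ↦ E.torsionGaloisModule ((p : ℤ) ^ j)) (fun j ↦ E.torsionGaloisModuleReduce p j) v)

/-! ## §1 The two-index transitions preserve `Fil_v`; the reductions preserve the twisted plus parts -/

omit [E.IsElliptic] hp in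
/-- `P ↦ p^{k'-k} P` maps `Fil_v E[p^{k'}]` into `Fil_v E[p^k]` (the one-step `OrdinaryFiltration.map_mem`, iterated).
[cite: Howard2004HeegnerKolyvagin, Def. 3.2.5 (arXiv p. 16: Fil_v T compatible with the tower)] [cite: GreenbergLNM1716, §2] -/
theorem torsionGaloisModuleReduceLE_mem_fil {k k' : ℕ} (h : k ≤ k') {a : geomTorsion E ((p : ℤ) ^ k')}
    (ha : a ∈ Φ.fil k') : E.torsionGaloisModuleReduceLE p h a ∈ Φ.fil k := by
  obtain ⟨d, rfl⟩ := Nat.exists_eq_add_of_le h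
  induction d with
  | zero => rw [E.torsionGaloisModuleReduceLE_refl]; exact ha
  | succ d ih =>
    have hstep : E.torsionGaloisModuleReduceLE p (Nat.le_succ (k + d)) a ∈ Φ.fil (k + d) := by
      rw [E.torsionGaloisModuleReduceLE_succ]
      exact Φ.map_mem (k + d) a ha
    have := ih (Nat.le_add_right k d) hstep
    rwa [← E.torsionGaloisModuleReduceLE_trans] at this

omit [E.IsElliptic] in
/-- `(c ⊗ a) ↦ (c mod) ⊗ p^{k'-k} a` carries `Fil_v T^{(k')} = A ⊗ Fil_v E[p^{k'}]` into `Fil_v T^{(k)}`.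
[cite: Howard2004HeegnerKolyvagin, §3.1 and Def. 3.2.5 (arXiv p. 15 L56–62, p. 16)] -/
theorem eisensteinTwistReduce_mem_twistedFil {k k' : ℕ} (h : k ≤ k')
    {x : IwasawaAlgebra.EisensteinCoeff.Twisted p m k' (geomTorsion E ((p : ℤ) ^ k'))} (hx : x ∈ Φ.twistedFil k') :
    κ.eisensteinTwistReduce hm h (E.torsionGaloisModuleReduceLE p h) x ∈ Φ.twistedFil k := by
  induction hx using Submodule.span_induction with
  | mem y hy =>
    obtain ⟨c, a, ha, rfl⟩ := hy
    rw [ZpExtension.eisensteinTwistReduce_tmul]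
    exact Φ.tmul_mem_twistedFil k _ (E.torsionGaloisModuleReduceLE_mem_fil Φ h ha)
  | zero => rw [map_zero]; exact zero_mem _
  | add y z _ _ hy hz => rw [map_add]; exact add_mem hy hz
  | smul n y _ hy => rw [map_zsmul]; exact Submodule.smul_mem _ n hy

/-- **The reductions of the datum carry `Fil_v T^{(k')}` into `Fil_v T^{(k)}`**.
[cite: Howard2004HeegnerKolyvagin, §3.1 and Def. 3.2.5 (arXiv p. 15 L56–62, p. 16)] -/
theorem red_mem_twistedFil {k k' : ℕ} (h : k ≤ k') {x : EisensteinLevel p m (fun j ↦ geomTorsion E ((p : ℤ) ^ j)) k'}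
    (hx : (x : IwasawaAlgebra.EisensteinCoeff.Twisted p m k' (geomTorsion E ((p : ℤ) ^ k'))) ∈ Φ.twistedFil k') :
    ((E.eisensteinPiRefinementDatum κ hm).red h x :
      IwasawaAlgebra.EisensteinCoeff.Twisted p m k (geomTorsion E ((p : ℤ) ^ k))) ∈ Φ.twistedFil k :=
  E.eisensteinTwistReduce_mem_twistedFil κ hm Φ h hx

/-- Between numerically equal levels the reduction is onto `Fil_v` (it is the identity).
[cite: Howard2004HeegnerKolyvagin, §1.6 (arXiv p. 12: T/𝔪^{e_k} in two cofinal systems)] -/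
theorem exists_red_eq_of_mem_twistedFil {k k' : ℕ} (hkk : k = k') (h : k ≤ k')
    {x : EisensteinLevel p m (fun j ↦ geomTorsion E ((p : ℤ) ^ j)) k}
    (hx : (x : IwasawaAlgebra.EisensteinCoeff.Twisted p m k (geomTorsion E ((p : ℤ) ^ k))) ∈ Φ.twistedFil k) :
    ∃ w : EisensteinLevel p m (fun j ↦ geomTorsion E ((p : ℤ) ^ j)) k',
      (w : IwasawaAlgebra.EisensteinCoeff.Twisted p m k' (geomTorsion E ((p : ℤ) ^ k'))) ∈ Φ.twistedFil k' ∧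
        (E.eisensteinPiRefinementDatum κ hm).red h w = x := by
  subst hkk
  exact ⟨x, hx, (E.eisensteinPiRefinementDatum κ hm).red_refl k x⟩

/-! ## §2 The plus parts and ordinary cores of the `π`-adic levels -/

/-- **`Fil_v (T/π^aT)`**: the image of `Fil_v T^{(host a)} = A ⊗ Fil_v E[p^{host a}]` in the `π`-adic level `T/π^aT`.
[cite: Howard2004HeegnerKolyvagin, §3.1 and Def. 3.1.2 (arXiv p. 15 L56–62, L99–108: Fil_v and H¹_ord propagated)] -/
def piFil (a : ℕ) : Submodule ℤ ((E.eisensteinPiRefinementDatum κ hm).Level a) :=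
  ((Φ.twistedFil ((E.eisensteinPiRefinementDatum κ hm).host a) :
      Submodule ℤ (EisensteinLevel p m (fun j ↦ geomTorsion E ((p : ℤ) ^ j)) ((E.eisensteinPiRefinementDatum κ hm).host a)))).map
    ((E.eisensteinPiRefinementDatum κ hm).piPow _ a).mkQ.toAddMonoidHom.toIntLinearMap

/-- Membership in `piFil`: `y = [x]` with `x ∈ Fil_v T^{(host a)}`. [cite: Howard2004HeegnerKolyvagin, §3.1 (arXiv p. 15)] -/
theorem mem_piFil_iff (a : ℕ) (y : (E.eisensteinPiRefinementDatum κ hm).Level a) :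
    y ∈ E.piFil κ hm Φ a ↔
      ∃ x : EisensteinLevel p m (fun j ↦ geomTorsion E ((p : ℤ) ^ j)) ((E.eisensteinPiRefinementDatum κ hm).host a),
        (x : IwasawaAlgebra.EisensteinCoeff.Twisted p m _ (geomTorsion E ((p : ℤ) ^ _))) ∈
            Φ.twistedFil ((E.eisensteinPiRefinementDatum κ hm).host a) ∧
          Submodule.Quotient.mk x = y :=
  Submodule.mem_map

/-- `Fil_v (T/π^aT)` is `Γ_{K_v}`-stable. [cite: Howard2004HeegnerKolyvagin, §3.1 (arXiv p. 15: Fil_v is a G_{K_v}-submodule)] -/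
theorem piFil_le_comap (a : ℕ) (σ : absoluteGaloisGroup (v.adicCompletion K)) :
    E.piFil κ hm Φ a ≤ (E.piFil κ hm Φ a).comap
      (GaloisRep.toLocal v ((E.eisensteinPiRefinementDatum κ hm).levelRep a) σ) := by
  intro y hy
  obtain ⟨x, hx, rfl⟩ := (E.mem_piFil_iff κ hm Φ a y).mp hy
  rw [Submodule.mem_comap, GaloisRep.toLocal_apply, PiRefinementDatum.levelRep_apply_mk]
  exact (E.mem_piFil_iff κ hm Φ a _).mpr ⟨_, Φ.twistedFil_le_comap hm _ σ hx, rfl⟩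

/-- **The ordinary core of the `π`-adic level**: `ker (H¹(K_v, T/π^aT) → H¹(K_v, (T/π^aT)/Fil_v))`.
[cite: Howard2004HeegnerKolyvagin, §3.1 and Def. 3.1.2 (arXiv p. 15 L62–66, L99–108)] -/
abbrev piOrdinaryCore (a : ℕ) :
    AddSubgroup (galoisCohomology (GaloisRep.toLocal v ((E.eisensteinPiRefinementDatum κ hm).levelRep a)) 1) :=
  strictSubgroup (GaloisRep.toLocal v ((E.eisensteinPiRefinementDatum κ hm).levelRep a)) (E.piFil κ hm Φ a)
    (E.piFil_le_comap κ hm Φ a)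

/-- (hCG) the reductions `H¹(map a b)` (`b ≤ a`) carry the `π`-adic ordinary cores into each other.
[cite: Howard2004HeegnerKolyvagin, §3.1 (arXiv p. 15: H¹_ord functorial)] -/
theorem mapH_mem_piOrdinaryCore {a b : ℕ} (hba : b ≤ a)
    {w : galoisCohomology (GaloisRep.toLocal v ((E.eisensteinPiRefinementDatum κ hm).levelRep a)) 1}
    (hw : w ∈ E.piOrdinaryCore κ hm Φ a) : (E.eisensteinPiRefinementDatum κ hm).mapH v a b w ∈ E.piOrdinaryCore κ hm Φ b := by
  refine map_mem_strictSubgroup _ _ _ _ _ (fun y hy ↦ ?_) hw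
  obtain ⟨x, hx, rfl⟩ := (E.mem_piFil_iff κ hm Φ a y).mp hy
  rw [localIntertwining_apply, LinearMap.toAddMonoidHom_coe]
  have hxp : (Submodule.Quotient.mk x : (E.eisensteinPiRefinementDatum κ hm).Level a) =
      (E.eisensteinPiRefinementDatum κ hm).proj (le_refl _) x := by
    rw [PiRefinementDatum.proj_apply, PiRefinementDatum.red_refl]
  rw [hxp, PiRefinementDatum.map_proj _ a b le_rfl ((E.eisensteinPiRefinementDatum κ hm).host_mono hba),
    Nat.sub_eq_zero_of_le hba, pow_zero, one_smul, PiRefinementDatum.proj_apply]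
  exact (E.mem_piFil_iff κ hm Φ b _).mpr ⟨_, E.red_mem_twistedFil κ hm Φ _ hx, rfl⟩

/-- (hCGs) the `π`-adic ordinary cores are `S_𝔮`-submodules. [cite: Howard2004HeegnerKolyvagin, Def. 1.1.1 and §3.1 (arXiv p. 5 L20–21, p. 15)] -/
theorem scalarMapH1_mem_piOrdinaryCore (a : ℕ)
    (r : IwasawaAlgebra p ⧸ Ideal.span {(PowerSeries.X ^ m + PowerSeries.C (p : ℤ_[p]) : IwasawaAlgebra p)})
    {y : galoisCohomology (GaloisRep.toLocal v ((E.eisensteinPiRefinementDatum κ hm).levelRep a)) 1}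
    (hy : y ∈ E.piOrdinaryCore κ hm Φ a) :
    galoisCohomology.scalarMapH1 (GaloisRep.toLocal v ((E.eisensteinPiRefinementDatum κ hm).levelRep a))
      (((E.eisensteinPiRefinementDatum κ hm).isScalarLinear_levelRep a).restrictField _) r y ∈ E.piOrdinaryCore κ hm Φ a := by
  refine Literature.NumberTheory.EllipticCurves.DiscreteGaloisModule.scalarMapH1_mem_strictSubgroup _ _ _ r
    (fun z hz ↦ ?_) hy
  obtain ⟨x, hx, rfl⟩ := (E.mem_piFil_iff κ hm Φ a z).mp hz
  obtain ⟨f, rfl⟩ := Ideal.Quotient.mk_surjective r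
  rw [← Submodule.Quotient.mk_smul, ZpExtension.EisensteinLevel.quotient_mk_smul_def]
  exact (E.mem_piFil_iff κ hm Φ a _).mpr ⟨_, Φ.smul_mem_twistedFil _ _ hx, rfl⟩

/-- (hCPG) **`H¹(proj_j)` carries the ordinary core of `T^{(j)}` ONTO the `π`-adic ordinary core at level `mj`**
(`proj_j` is an equivariant bijection with `proj_j(Fil_v T^{(j)}) = Fil_v(T/π^{mj})`, `host (mj) = j`).
[cite: Howard2004HeegnerKolyvagin, §3.1 and §1.6 (arXiv p. 15, p. 12 L29–55)] -/
theorem map_projH_ordinaryCore_eq (j : ℕ) :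
    (Φ.ordinaryCore hm j).map ((E.eisensteinPiRefinementDatum κ hm).projH v
      (E.eisensteinPiRefinementDatum_host_mul_le κ hm j)) = E.piOrdinaryCore κ hm Φ (m * j) := by
  set D := E.eisensteinPiRefinementDatum κ hm
  refine map_strictSubgroup_eq_of_bijective _ (D.proj_bijective (E.eisensteinPiRefinementDatum_host_mul_le κ hm j) rfl)
    _ _ _ _ (fun w hw ↦ ?_) (fun w' hw' ↦ ?_)
  · exact (E.mem_piFil_iff κ hm Φ _ _).mpr
      ⟨D.red _ (w : EisensteinLevel p m (fun j ↦ geomTorsion E ((p : ℤ) ^ j)) j),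
        E.red_mem_twistedFil κ hm Φ _ (x := (w : EisensteinLevel p m (fun j ↦ geomTorsion E ((p : ℤ) ^ j)) j)) hw,
        rfl⟩
  · obtain ⟨x, hx, rfl⟩ := (E.mem_piFil_iff κ hm Φ _ w').mp hw'
    obtain ⟨w, hw, hwx⟩ := E.exists_red_eq_of_mem_twistedFil κ hm Φ (ZpExtension.ceilDiv_mul hm j)
      (E.eisensteinPiRefinementDatum_host_mul_le κ hm j) hx
    exact ⟨w, hw, congrArg Submodule.Quotient.mk hwx⟩

/-! ## §3 H.3 at the places `v ∣ p` and at every place of `Σ(F)` -/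

/-- **Howard's H.3 for `F_𝔮` at a place `v ∣ p`, over the level ring `A_{m,k+1}`** (ordinary cores), for the curve's
Eisenstein tower. [cite: Howard2004HeegnerKolyvagin, H.3 with Def. 1.1.2–1.1.3, §3.1 and Def. 3.1.2 (arXiv p. 7 L65–67, p. 15–16)]
[cite: MazurRubinMemoirs2004, Lemma 3.7.1] -/
theorem isCartesianOnQuotAt_eisensteinSelmerStructure_of_mem (W : WeierstrassCurve ℚ) [W.IsElliptic]
    (S : Finset (HeightOneSpectrum (𝓞 K)))
    (Φ : ∀ v : HeightOneSpectrum (𝓞 K), ((p : ℕ) : 𝓞 K) ∈ v.asIdeal →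
      OrdinaryFiltration (fun j ↦ (W.baseChange K).torsionGaloisModule ((p : ℤ) ^ j))
        (fun j ↦ (W.baseChange K).torsionGaloisModuleReduce p j) v)
    (k : ℕ) {v : HeightOneSpectrum (𝓞 K)} (hv : ((p : ℕ) : 𝓞 K) ∈ v.asIdeal) :
    letI := IwasawaAlgebra.isLocalRing_quotient_X_pow_add_C p hm
    IsCartesianOnQuotAt ((W.eisensteinTower κ hm).ρ k) (IwasawaAlgebra.EisensteinCoeff p m (k + 1)) (Sum.inr v)
      (κ.eisensteinSelmerStructure (fun j ↦ (W.baseChange K).torsionGaloisModule ((p : ℤ) ^ j))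
        (fun j ↦ (W.baseChange K).torsionGaloisModuleReduce p j) hm S Φ (k + 1) (Sum.inr v)) := by
  letI := IwasawaAlgebra.isLocalRing_quotient_X_pow_add_C p hm
  set D := (W.baseChange K).eisensteinPiRefinementDatum κ hm with hD
  letI := IwasawaAlgebra.EisensteinCoeff.algebraOfSpec p m (k + 1)
  haveI := ZpExtension.EisensteinLevel.isScalarTower_algebraOfSpec p m
    (fun j ↦ geomTorsion (W.baseChange K) ((p : ℤ) ^ j)) (k + 1)
  haveI := IwasawaAlgebra.EisensteinCoeff.isLocalRing_eisensteinCoeff p hm k.succ_pos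
  haveI : Module.Free (IwasawaAlgebra.EisensteinCoeff p m (k + 1))
      (EisensteinLevel p m (fun j ↦ geomTorsion (W.baseChange K) ((p : ℤ) ^ j)) (k + 1)) :=
    (W.baseChange K).free_eisensteinLevel_geomTorsion (p := p) (m := m) (k + 1)
  haveI : ∀ a, Finite (D.Level a) := fun a ↦ (W.baseChange K).finite_eisensteinPiRefinementDatum_level κ hm a
  have hlinA : (D.ρ (k + 1)).IsScalarLinear (IwasawaAlgebra.EisensteinCoeff p m (k + 1)) :=
    κ.isScalarLinear_eisensteinTwist ((W.baseChange K).torsionGaloisModule ((p : ℤ) ^ (k + 1))) hm (k + 1)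
  rw [κ.eisensteinSelmerStructure_inr_of_mem _ _ hm S Φ (k + 1) hv]
  have hred : (κ.eisensteinLocalReduce (fun j ↦ (W.baseChange K).torsionGaloisModule ((p : ℤ) ^ j))
      (fun j ↦ (W.baseChange K).torsionGaloisModuleReduce p j) hm (Sum.inr v)) =
      fun j ↦ D.redH v (Nat.le_succ j) :=
    funext fun j ↦ ((W.baseChange K).redH_eisensteinPiRefinementDatum_eq_eisensteinLocalReduce κ hm v j).symm
  rw [hred]
  have hmaxA : IsLocalRing.maximalIdeal (IwasawaAlgebra.EisensteinCoeff p m (k + 1)) =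
      Ideal.span {algebraMap (IwasawaAlgebra p ⧸
        Ideal.span {(PowerSeries.X ^ m + PowerSeries.C (p : ℤ_[p]) : IwasawaAlgebra p)})
        (IwasawaAlgebra.EisensteinCoeff p m (k + 1)) D.π} := by
    rw [IwasawaAlgebra.EisensteinCoeff.maximalIdeal_eisensteinCoeff_eq p hm k.succ_pos]
    rfl
  refine D.isCartesianOnQuotAt_levelCondition_of_finite v hlinA p
    (fun j ↦ (Φ v hv).ordinaryCore hm j) hm
    (fun j ↦ (W.baseChange K).eisensteinPiRefinementDatum_host_mul_le κ hm j) (fun j ↦ rfl)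
    ((W.baseChange K).natCast_mem_span_pi κ hm)
    (fun a ↦ (W.baseChange K).piOrdinaryCore κ hm (Φ v hv) a)
    (fun a b hba w hw ↦ (W.baseChange K).mapH_mem_piOrdinaryCore κ hm (Φ v hv) hba hw)
    (fun a r y hy ↦ (W.baseChange K).scalarMapH1_mem_piOrdinaryCore κ hm (Φ v hv) a r hy)
    (fun j ↦ (W.baseChange K).map_projH_ordinaryCore_eq κ hm (Φ v hv) j)
    hmaxA (IwasawaAlgebra.EisensteinCoeff.isPrincipalArtinianOfLength (p := p) hm k.succ_pos) ?_
  intro a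
  rintro _ ⟨x, hx, rfl⟩
  have hstab := κ.isScalarStable_eisensteinSelmerStructure
    (fun j ↦ (W.baseChange K).torsionGaloisModule ((p : ℤ) ^ j))
    (fun j ↦ (W.baseChange K).torsionGaloisModuleReduce p j) hm S Φ (k + 1) (Sum.inr v) a
    (x := x) (by
      rw [κ.eisensteinSelmerStructure_inr_of_mem _ _ hm S Φ (k + 1) hv, hred]
      exact hx)
  rw [κ.eisensteinSelmerStructure_inr_of_mem _ _ hm S Φ (k + 1) hv, hred] at hstab
  exact hstab

/-- **H.3 for `F_𝔮` at every finite place `v ∈ S`** (split on `v ∣ p` / `v ∤ p`).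
[cite: Howard2004HeegnerKolyvagin, H.3 (arXiv p. 7 L65–67) with Def. 3.1.2 (p. 15–16)] -/
theorem isCartesianOnQuotAt_eisensteinSelmerStructure_inr (W : WeierstrassCurve ℚ) [W.IsElliptic]
    (S : Finset (HeightOneSpectrum (𝓞 K)))
    (Φ : ∀ v : HeightOneSpectrum (𝓞 K), ((p : ℕ) : 𝓞 K) ∈ v.asIdeal →
      OrdinaryFiltration (fun j ↦ (W.baseChange K).torsionGaloisModule ((p : ℤ) ^ j))
        (fun j ↦ (W.baseChange K).torsionGaloisModuleReduce p j) v)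
    (k : ℕ) {v : HeightOneSpectrum (𝓞 K)} (hvS : v ∈ S) :
    letI := IwasawaAlgebra.isLocalRing_quotient_X_pow_add_C p hm
    IsCartesianOnQuotAt ((W.eisensteinTower κ hm).ρ k) (IwasawaAlgebra.EisensteinCoeff p m (k + 1)) (Sum.inr v)
      (κ.eisensteinSelmerStructure (fun j ↦ (W.baseChange K).torsionGaloisModule ((p : ℤ) ^ j))
        (fun j ↦ (W.baseChange K).torsionGaloisModuleReduce p j) hm S Φ (k + 1) (Sum.inr v)) := by
  by_cases hv : ((p : ℕ) : 𝓞 K) ∈ v.asIdeal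
  · exact W.isCartesianOnQuotAt_eisensteinSelmerStructure_of_mem κ hm S Φ k hv
  · exact W.isCartesianOnQuotAt_eisensteinSelmerStructure_of_not_mem κ hm S Φ k hv hvS

/-- **`SatisfiesH.h3` for the curve's Eisenstein setting, discharged** (`K` totally complex, e.g. imaginary quadratic):
Howard's H.3 holds for `(T^{(k)}, F_𝔮, 𝓛) = W.eisensteinTowerTriple …` over the level ring `A_{m,k+1}` at every level `k` —
the hypothesis `h3` of `eisensteinDVRSettingTame_satisfiesH_of`, verbatim (complex places: `eisensteinDVRSetting_h3_of`;
`v ∣ p`: ordinary cores; `v ∈ S`, `v ∤ p`: saturated unramified cores).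
[cite: Howard2004HeegnerKolyvagin, H.3 (arXiv p. 7 L65–67), Def. 3.1.2 and Def. 3.2.5 (p. 15–16)]
[cite: MazurRubinMemoirs2004, Lemma 3.7.1] -/
theorem eisensteinDVRSetting_h3 [NumberField.IsTotallyComplex K] (W : WeierstrassCurve ℚ) [W.IsElliptic]
    (S : Finset (HeightOneSpectrum (𝓞 K)))
    (hpS : ∀ v : HeightOneSpectrum (𝓞 K), ((p : ℕ) : 𝓞 K) ∈ v.asIdeal → v ∈ S)
    (hbad : ∀ v : HeightOneSpectrum (𝓞 K), v ∉ S → ((p : ℕ) : 𝓞 K) ∉ v.asIdeal →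
      (W.baseChange K).HasGoodReductionAt v)
    (L : Set (HeightOneSpectrum (𝓞 K)))
    (hL : letI := IwasawaAlgebra.isLocalRing_quotient_X_pow_add_C p hm
      L ⊆ (W.eisensteinTower κ hm).degreeTwoPrimes p)
    (hLS : ∀ v ∈ L, v ∉ S) (k : ℕ) :
    letI := IwasawaAlgebra.isLocalRing_quotient_X_pow_add_C p hm
    H3 ((W.eisensteinTower κ hm).ρ k) (IwasawaAlgebra.EisensteinCoeff p m (k + 1))
      (W.eisensteinTowerTriple κ hm S hpS hbad L hL hLS k) :=
  W.eisensteinDVRSetting_h3_of κ hm S hpS hbad L hL hLS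
    (fun k _ hvS ↦ W.isCartesianOnQuotAt_eisensteinSelmerStructure_inr κ hm S
      (fun v _ ↦ (W.baseChange K).ordinaryFiltrationAt v (fun j ↦ (W.baseChange K).torsionGaloisModuleReduce p j)
        (fun _ _ ↦ rfl)) k hvS) k

/-- The same with Howard's frame hypothesis `K` imaginary quadratic (the `hK` of `eisensteinDVRSettingTame_satisfiesH_of`).
[cite: Howard2004HeegnerKolyvagin, §0 and H.3 (arXiv p. 2, p. 7 L65–67)] -/
theorem eisensteinDVRSetting_h3_of_isImaginaryQuadratic (hK : IsImaginaryQuadratic K) (W : WeierstrassCurve ℚ)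
    [W.IsElliptic] (S : Finset (HeightOneSpectrum (𝓞 K)))
    (hpS : ∀ v : HeightOneSpectrum (𝓞 K), ((p : ℕ) : 𝓞 K) ∈ v.asIdeal → v ∈ S)
    (hbad : ∀ v : HeightOneSpectrum (𝓞 K), v ∉ S → ((p : ℕ) : 𝓞 K) ∉ v.asIdeal →
      (W.baseChange K).HasGoodReductionAt v)
    (L : Set (HeightOneSpectrum (𝓞 K)))
    (hL : letI := IwasawaAlgebra.isLocalRing_quotient_X_pow_add_C p hm
      L ⊆ (W.eisensteinTower κ hm).degreeTwoPrimes p)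
    (hLS : ∀ v ∈ L, v ∉ S) (k : ℕ) :
    letI := IwasawaAlgebra.isLocalRing_quotient_X_pow_add_C p hm
    H3 ((W.eisensteinTower κ hm).ρ k) (IwasawaAlgebra.EisensteinCoeff p m (k + 1))
      (W.eisensteinTowerTriple κ hm S hpS hbad L hL hLS k) :=
  haveI := hK.isTotallyComplex
  W.eisensteinDVRSetting_h3 κ hm S hpS hbad L hL hLS k

end WeierstrassCurve

end
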